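import Mathlib

/-!
# SoloBlind — active-cluster bound (combinatorial core)

Solo programme `solo-HodgeConjecture-blind`, session s139 (WILD88 proviso P4, all strata).

In the wild-cluster analysis of tangent-hyperplane sections of `X₁₀ = {Σ xᵢ⁶ + 10 ∏ xᵢ = 0}`
near a type-11 vertex, the 25 satellite clusters are indexed by `c̃ ∈ 𝔽₅³` with `Σ c̃ᵢ = 0`,
i.e. by `c = (c₀, c₁) ∈ 𝔽₅²` (`c̃ = (c₀, c₁, -c₀-c₁)`).  The order-`λ` term of the u-free node
functional at cluster `c̃` is `θ · (θ‖c̃‖² − ⟨c̃, D⟩)` where `D` is the level-`λ` second-block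
digit vector of the tangency point (computed symbolically in all three strata: principal
`λ = σ⁴`, critical `λ = σ³·unit`, far `λ = σ³`; memo `work/s139/e13.md` §7).  Since
`‖c̃‖² = 2·N(c)` with `N(c) = c₀² + c₀c₁ + c₁²` and `⟨c̃, D⟩ = e₀c₀ + e₁c₁`
(`e₀ = D₃ − D₅`, `e₁ = D₄ − D₅`, rescaled by `θ`), a cluster `c ≠ 0` can carry nodes only if
`2·N(c) = e₀c₀ + e₁c₁`.

This file certifies the finite core of the ACTIVE-CLUSTER LEMMA: for every `𝔽₅`-rational
`(e₀, e₁)` at most 5 nonzero `c` satisfy the activity equation (exactly 5 when `e ≠ 0`, none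
when `e = 0`), because `N` is anisotropic over `𝔽₅`, so the affine conic `2N(c) = ⟨e, c⟩`
through the origin has all its 6 projective points affine.  (The reduction of an arbitrary
`e ∈ k̄²` to the rational case is linear algebra recorded in the memo.)  Hence at most
6 of the 25 clusters (the own cluster `c = 0` and ≤ 5 foreign ones) are active.
-/

namespace Summit.HodgeConjecture.HodgeConjecture.Theorems

/-- The norm form `N(c) = c₀² + c₀ c₁ + c₁²` on `𝔽₅²` (the form `a² + ab + b²` of the
kernel channel, now on cluster indices). -/
def clusterNorm (c : ZMod 5 × ZMod 5) : ZMod 5 := c.1 ^ 2 + c.1 * c.2 + c.2 ^ 2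

/-- The activity predicate of cluster `c` for the (rescaled, rational) digit functional `e`
(an `abbrev`, so that its decidability is inferred from `ZMod 5`). -/
abbrev clusterActive (e c : ZMod 5 × ZMod 5) : Prop :=
  2 * clusterNorm c = e.1 * c.1 + e.2 * c.2

/-- `N` is anisotropic over `𝔽₅` (there is no primitive cube root of unity in `𝔽₅`). -/
theorem clusterNorm_eq_zero_iff (c : ZMod 5 × ZMod 5) : clusterNorm c = 0 ↔ c = 0 := by
  revert c; decide

/-- The set of active foreign clusters for the digit functional `e`. -/
def activeForeign (e : ZMod 5 × ZMod 5) : Finset (ZMod 5 × ZMod 5) :=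
  Finset.univ.filter fun c => c ≠ 0 ∧ clusterActive e c

/-- ACTIVE-CLUSTER LEMMA, finite core: at most 5 foreign clusters are active. -/
theorem card_activeForeign_le (e : ZMod 5 × ZMod 5) : (activeForeign e).card ≤ 5 := by
  revert e; decide

/-- Sharpness: for `e ≠ 0` exactly 5 foreign clusters are active (the affine conic
`2N(c) = ⟨e, c⟩` is an ellipse through the origin with all 6 of its points affine). -/
theorem card_activeForeign_eq (e : ZMod 5 × ZMod 5) (he : e ≠ 0) :
    (activeForeign e).card = 5 := by
  revert e; decide

/-- For `e = 0` no foreign cluster is active (anisotropy). -/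
theorem activeForeign_zero : activeForeign 0 = ∅ := by decide

/-- The own cluster `c = 0` is always active. -/
theorem clusterActive_zero (e : ZMod 5 × ZMod 5) : clusterActive e 0 := by
  simp [clusterActive, clusterNorm]

/-- Hence at most 6 clusters (own + foreign) are active for any rational digit functional. -/
theorem card_active_le (e : ZMod 5 × ZMod 5) :
    (Finset.univ.filter fun c => clusterActive e c).card ≤ 6 := by
  revert e; decide

end Summit.HodgeConjecture.HodgeConjecture.Theorems
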